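import Mathlib.MeasureTheory.Function.ConditionalExpectation.Real
import Mathlib.MeasureTheory.Integral.IntegrableOn
import HarnessLib

/-!
# The law of total covariance, lower-bound form, through a sub-σ-algebra

Topic `Literature/Probability/Moments` (kind proof; no new notions).  Companion of
`OscillationCovariance.lean` (same namespace), which states the law of total covariance with
KERNEL data (`H, K, Q` measurable functions standing for conditional expectations).  Here the
conditioning is Mathlib's conditional expectation `μ[·|m]` with respect to a sub-σ-algebra
`m ≤ m₀` of a probability space:

* `integral_mul_sub_ge_neg_mul_of_ae_abs_le` — **covariance of two a.e.-small variables**: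
  if `|u| ≤ ε₁` and `|w| ≤ ε₂` almost everywhere then `∫ uw - ∫ u ∫ w ≥ -ε₁ ε₂`
  (`Cov(u,w) = ∫ (u-ū)(w-w̄) ≥ -(s ∫(u-ū)² + s⁻¹ ∫(w-w̄)²)/2 ≥ -(s ε₁² + ε₂²/s)/2`, `s = ε₂/ε₁`;
  the degenerate cases `ε₁ ε₂ = 0` by continuity in `(ε₁, ε₂)`);
* `total_covariance_lower_bound_condExp` — **law of total covariance, lower form**: for bounded
  `m₀`-measurable `f, g`, if a.e. `μ[fg|m] - μ[f|m] μ[g|m] ≥ θ` and the conditional means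
  `μ[f|m]`, `μ[g|m]` lie a.e. within `ε₁`, `ε₂` of constants, then
  `∫ fg - ∫ f ∫ g ≥ θ - ε₁ ε₂`
  (`Cov(f,g) = E[Cov(f,g|m)] + Cov(E[f|m], E[g|m])` via `integral_condExp`, and the previous
  bullet for the covariance of the conditional means; Durrett 2019 §4.1).

Consumed by block-conditioning arguments for lattice gauge theory correlators (the
`block-conditioned-covariance` line of the tuned-sequence problem), where `m = σ(V)` for a block
field `V`.

## Mathlib

We USE `MeasureTheory.integral_condExp`, `integrable_condExp`, `stronglyMeasurable_condExp`,
`Integrable.of_bound`, `Integrable.bdd_mul`, `integral_mono_ae`, `le_of_tendsto`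
(no hypothesis on `f, g` is needed in the final statement: `μ[·|m]` and `∫` vanish together on
non-integrable input).  Mathlib
(pinned) has `ProbabilityTheory.condVar` identities but no law of total covariance
(searched `total_covariance`, `condCov`, `covariance_condExp`).

## References

* R. Durrett, *Probability: Theory and Examples*, 5th ed. (CUP 2019), §4.1 (conditional
  expectation; law of total variance/covariance, Ex. 4.1.7).
-/

noncomputable section

open MeasureTheory Filter Topology

namespace Literature.Probability.Moments

section Centred

variable {Ω : Type*} [MeasurableSpace Ω] {μ : Measure Ω}

/-- Core case of `integral_mul_sub_ge_neg_mul_of_ae_abs_le` with `ε₁, ε₂ > 0`: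
`∫ uw - ∫ u ∫ w = ∫ (u-ū)(w-w̄) ≥ -(s ∫(u-ū)² + s⁻¹ ∫(w-w̄)²)/2 ≥ -(s ε₁² + ε₂²/s)/2 = -ε₁ε₂`
at `s = ε₂/ε₁`. [folklore] -/
theorem integral_mul_sub_ge_neg_mul_of_ae_abs_le_of_pos [IsProbabilityMeasure μ] {u w : Ω → ℝ}
    (hu : AEStronglyMeasurable u μ) (hw : AEStronglyMeasurable w μ) {ε₁ ε₂ : ℝ} (hε₁ : 0 < ε₁)
    (hε₂ : 0 < ε₂) (hub : ∀ᵐ ω ∂μ, |u ω| ≤ ε₁) (hwb : ∀ᵐ ω ∂μ, |w ω| ≤ ε₂) :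
    -(ε₁ * ε₂) ≤ (∫ ω, u ω * w ω ∂μ) - (∫ ω, u ω ∂μ) * ∫ ω, w ω ∂μ := by
  have hub' : ∀ᵐ ω ∂μ, ‖u ω‖ ≤ ε₁ := hub.mono fun ω h => by simpa [Real.norm_eq_abs] using h
  have hwb' : ∀ᵐ ω ∂μ, ‖w ω‖ ≤ ε₂ := hwb.mono fun ω h => by simpa [Real.norm_eq_abs] using h
  have hui : Integrable u μ := Integrable.of_bound hu ε₁ hub'
  have hwi : Integrable w μ := Integrable.of_bound hw ε₂ hwb'
  have huw : Integrable (fun ω => u ω * w ω) μ := hwi.bdd_mul hu hub'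
  have hu2 : Integrable (fun ω => u ω * u ω) μ := hui.bdd_mul hu hub'
  have hw2 : Integrable (fun ω => w ω * w ω) μ := hwi.bdd_mul hw hwb'
  -- the means
  obtain ⟨ub, hubdef⟩ : ∃ ub : ℝ, ∫ ω, u ω ∂μ = ub := ⟨_, rfl⟩
  obtain ⟨wb, hwbdef⟩ : ∃ wb : ℝ, ∫ ω, w ω ∂μ = wb := ⟨_, rfl⟩
  -- second moments of the centred variables
  have hx2 : ∫ ω, (u ω - ub) ^ 2 ∂μ ≤ ε₁ ^ 2 := by
    have hid : (fun ω => (u ω - ub) ^ 2) = fun ω => u ω * u ω - (2 * ub) * u ω + ub ^ 2 := by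
      funext ω; ring
    have h1 : ∫ ω, u ω * u ω ∂μ ≤ ε₁ ^ 2 := by
      have := integral_mono_ae hu2 (integrable_const (ε₁ ^ 2))
        (hub.mono fun ω h => show u ω * u ω ≤ ε₁ ^ 2 by
          have := abs_le.mp h; nlinarith)
      simpa [integral_const, probReal_univ] using this
    have hA : Integrable (fun ω => u ω * u ω - 2 * ub * u ω) μ := hu2.sub (hui.const_mul _)
    rw [hid, integral_add hA (integrable_const _), integral_sub hu2 (hui.const_mul _),
      integral_const_mul, integral_const, probReal_univ, one_smul, hubdef]
    nlinarith [sq_nonneg ub]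
  have hy2 : ∫ ω, (w ω - wb) ^ 2 ∂μ ≤ ε₂ ^ 2 := by
    have hid : (fun ω => (w ω - wb) ^ 2) = fun ω => w ω * w ω - (2 * wb) * w ω + wb ^ 2 := by
      funext ω; ring
    have h1 : ∫ ω, w ω * w ω ∂μ ≤ ε₂ ^ 2 := by
      have := integral_mono_ae hw2 (integrable_const (ε₂ ^ 2))
        (hwb.mono fun ω h => show w ω * w ω ≤ ε₂ ^ 2 by
          have := abs_le.mp h; nlinarith)
      simpa [integral_const, probReal_univ] using this
    have hA : Integrable (fun ω => w ω * w ω - 2 * wb * w ω) μ := hw2.sub (hwi.const_mul _)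
    rw [hid, integral_add hA (integrable_const _), integral_sub hw2 (hwi.const_mul _),
      integral_const_mul, integral_const, probReal_univ, one_smul, hwbdef]
    nlinarith [sq_nonneg wb]
  -- the covariance as the mean of the product of the centred variables
  have hxi : Integrable (fun ω => (u ω - ub) ^ 2) μ := by
    have hid : (fun ω => (u ω - ub) ^ 2) = fun ω => u ω * u ω - (2 * ub) * u ω + ub ^ 2 := by
      funext ω; ring
    rw [hid]; exact (hu2.sub (hui.const_mul _)).add (integrable_const _)
  have hyi : Integrable (fun ω => (w ω - wb) ^ 2) μ := by
    have hid : (fun ω => (w ω - wb) ^ 2) = fun ω => w ω * w ω - (2 * wb) * w ω + wb ^ 2 := by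
      funext ω; ring
    rw [hid]; exact (hw2.sub (hwi.const_mul _)).add (integrable_const _)
  have hxyi : Integrable (fun ω => (u ω - ub) * (w ω - wb)) μ := by
    have hid : (fun ω => (u ω - ub) * (w ω - wb)) =
        fun ω => u ω * w ω - ub * w ω - wb * u ω + ub * wb := by
      funext ω; ring
    rw [hid]
    exact ((huw.sub (hwi.const_mul _)).sub (hui.const_mul _)).add (integrable_const _)
  have hcov : (∫ ω, u ω * w ω ∂μ) - (∫ ω, u ω ∂μ) * ∫ ω, w ω ∂μ =
      ∫ ω, (u ω - ub) * (w ω - wb) ∂μ := by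
    have hid : (fun ω => (u ω - ub) * (w ω - wb)) =
        fun ω => u ω * w ω - ub * w ω - wb * u ω + ub * wb := by
      funext ω; ring
    have hB : Integrable (fun ω => u ω * w ω - ub * w ω) μ := huw.sub (hwi.const_mul _)
    have hC : Integrable (fun ω => u ω * w ω - ub * w ω - wb * u ω) μ := hB.sub (hui.const_mul _)
    rw [hid, integral_add hC (integrable_const _), integral_sub hB (hui.const_mul _),
      integral_sub huw (hwi.const_mul _), integral_const_mul, integral_const_mul, integral_const,
      probReal_univ, one_smul, hubdef, hwbdef]
    ring
  -- AM–GM with the optimal weight `s = ε₂/ε₁`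
  set s : ℝ := ε₂ / ε₁ with hs
  have hs0 : 0 < s := div_pos hε₂ hε₁
  have hpt : ∀ ω, -((s * (u ω - ub) ^ 2 + (w ω - wb) ^ 2 / s) / 2) ≤ (u ω - ub) * (w ω - wb) := by
    intro ω
    have hid : (u ω - ub) * (w ω - wb) + (s * (u ω - ub) ^ 2 + (w ω - wb) ^ 2 / s) / 2 =
        (s * (u ω - ub) + (w ω - wb)) ^ 2 / (2 * s) := by
      field_simp
      ring
    have hnn : 0 ≤ (s * (u ω - ub) + (w ω - wb)) ^ 2 / (2 * s) := by positivity
    linarith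
  have hint : -((s * ε₁ ^ 2 + ε₂ ^ 2 / s) / 2) ≤ ∫ ω, (u ω - ub) * (w ω - wb) ∂μ := by
    have hI : Integrable (fun ω => -((s * (u ω - ub) ^ 2 + (w ω - wb) ^ 2 / s) / 2)) μ :=
      (((hxi.const_mul s).add (hyi.div_const s)).div_const 2).neg
    have hmono := integral_mono_ae hI hxyi (ae_of_all _ hpt)
    have heval : ∫ ω, -((s * (u ω - ub) ^ 2 + (w ω - wb) ^ 2 / s) / 2) ∂μ =
        -((s * ∫ ω, (u ω - ub) ^ 2 ∂μ + (∫ ω, (w ω - wb) ^ 2 ∂μ) / s) / 2) := by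
      rw [integral_neg, integral_div, integral_add (hxi.const_mul s) (hyi.div_const s),
        integral_const_mul, integral_div]
    rw [heval] at hmono
    have h1 : s * ∫ ω, (u ω - ub) ^ 2 ∂μ ≤ s * ε₁ ^ 2 := mul_le_mul_of_nonneg_left hx2 hs0.le
    have h2 : (∫ ω, (w ω - wb) ^ 2 ∂μ) / s ≤ ε₂ ^ 2 / s := div_le_div_of_nonneg_right hy2 hs0.le
    linarith
  have harith : (s * ε₁ ^ 2 + ε₂ ^ 2 / s) / 2 = ε₁ * ε₂ := by
    rw [hs]
    field_simp
    ring
  rw [hcov]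
  linarith

/-- **Covariance of two a.e.-small variables.**  If `|u| ≤ ε₁` and `|w| ≤ ε₂` almost everywhere on
a probability space, then `∫ uw - ∫ u ∫ w ≥ -ε₁ ε₂` (Cauchy–Schwarz for the covariance together
with `Var u ≤ ∫ u² ≤ ε₁²`; proved by AM–GM at the optimal weight and continuity in `(ε₁, ε₂)` for
the degenerate cases). [folklore] -/
theorem integral_mul_sub_ge_neg_mul_of_ae_abs_le [IsProbabilityMeasure μ] {u w : Ω → ℝ}
    (hu : AEStronglyMeasurable u μ) (hw : AEStronglyMeasurable w μ) {ε₁ ε₂ : ℝ}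
    (hub : ∀ᵐ ω ∂μ, |u ω| ≤ ε₁) (hwb : ∀ᵐ ω ∂μ, |w ω| ≤ ε₂) :
    -(ε₁ * ε₂) ≤ (∫ ω, u ω * w ω ∂μ) - (∫ ω, u ω ∂μ) * ∫ ω, w ω ∂μ := by
  obtain ⟨ω₀, hω₀⟩ := (hub.and hwb).exists
  have hε₁ : 0 ≤ ε₁ := (abs_nonneg _).trans hω₀.1
  have hε₂ : 0 ≤ ε₂ := (abs_nonneg _).trans hω₀.2
  -- for every `δ > 0` the core case applies to `(ε₁ + δ, ε₂ + δ)`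
  have hstep : ∀ δ : ℝ, 0 < δ →
      -((ε₁ + δ) * (ε₂ + δ)) ≤ (∫ ω, u ω * w ω ∂μ) - (∫ ω, u ω ∂μ) * ∫ ω, w ω ∂μ :=
    fun δ hδ => integral_mul_sub_ge_neg_mul_of_ae_abs_le_of_pos hu hw (by linarith) (by linarith)
      (hub.mono fun ω h => h.trans (by linarith)) (hwb.mono fun ω h => h.trans (by linarith))
  -- let `δ → 0⁺`
  have hlim : Tendsto (fun δ : ℝ => -((ε₁ + δ) * (ε₂ + δ))) (𝓝[>] 0) (𝓝 (-(ε₁ * ε₂))) := by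
    have hc : Continuous fun δ : ℝ => -((ε₁ + δ) * (ε₂ + δ)) := by fun_prop
    have := hc.tendsto 0
    simp only [add_zero] at this
    exact this.mono_left nhdsWithin_le_nhds
  exact le_of_tendsto hlim (eventually_nhdsWithin_of_forall fun δ hδ => hstep δ hδ)

end Centred

section CondExp

variable {Ω : Type*} {m m₀ : MeasurableSpace Ω} {μ : Measure Ω}

/-- **Law of total covariance, lower-bound form, through a sub-σ-algebra.**  On a probability
space `(Ω, m₀, μ)` let `m ≤ m₀` and `f, g : Ω → ℝ` (classically: bounded measurable, so that all
conditional expectations below are the honest ones).  If almost everywhere the conditional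
covariance `μ[fg|m] - μ[f|m] μ[g|m]` is `≥ θ` and the conditional means `μ[f|m]`, `μ[g|m]` lie
within `ε₁`, `ε₂` of constants `a`, `b`, then `∫ fg - ∫ f ∫ g ≥ θ - ε₁ ε₂`:
`Cov(f,g) = E[Cov(f,g | m)] + Cov(E[f|m], E[g|m])` (`integral_condExp` three times), the first
term `≥ θ`, the second `≥ -ε₁ε₂` by `integral_mul_sub_ge_neg_mul_of_ae_abs_le` applied to the
centred conditional means (Durrett 2019 §4.1).  No integrability hypothesis is stated: Mathlib's
`μ[·|m]` and `∫` share the convention "`0` on non-integrable input", under which the three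
total-expectation identities hold unconditionally, so the inequality as displayed is true for
all `f, g`. [folklore] -/
theorem total_covariance_lower_bound_condExp [IsProbabilityMeasure μ] (hm : m ≤ m₀)
    {f g : Ω → ℝ} {θ ε₁ ε₂ a b : ℝ}
    (hcov : ∀ᵐ ω ∂μ, θ ≤ (μ[f * g|m]) ω - (μ[f|m]) ω * (μ[g|m]) ω)
    (ha : ∀ᵐ ω ∂μ, |(μ[f|m]) ω - a| ≤ ε₁) (hb : ∀ᵐ ω ∂μ, |(μ[g|m]) ω - b| ≤ ε₂) :
    θ - ε₁ * ε₂ ≤ (∫ ω, f ω * g ω ∂μ) - (∫ ω, f ω ∂μ) * ∫ ω, g ω ∂μ := by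
  -- the conditional expectations
  set F : Ω → ℝ := μ[f|m] with hF
  set G : Ω → ℝ := μ[g|m] with hG
  set H : Ω → ℝ := μ[f * g|m] with hH
  have hFm : AEStronglyMeasurable F μ := (stronglyMeasurable_condExp.mono hm).aestronglyMeasurable
  have hGm : AEStronglyMeasurable G μ := (stronglyMeasurable_condExp.mono hm).aestronglyMeasurable
  have hFi : Integrable F μ := integrable_condExp
  have hGi : Integrable G μ := integrable_condExp
  have hHi : Integrable H μ := integrable_condExp
  have hFb : ∀ᵐ ω ∂μ, ‖F ω‖ ≤ |a| + ε₁ := ha.mono fun ω h => by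
    rw [Real.norm_eq_abs]
    have := abs_sub_abs_le_abs_sub (F ω) a
    linarith
  have hFGi : Integrable (fun ω => F ω * G ω) μ := hGi.bdd_mul hFm hFb
  -- (1) the three total-expectation identities
  have h1 : ∫ ω, f ω * g ω ∂μ = ∫ ω, H ω ∂μ := by
    rw [hH, integral_condExp hm]; rfl
  have h2 : ∫ ω, f ω ∂μ = ∫ ω, F ω ∂μ := by rw [hF, integral_condExp hm]
  have h3 : ∫ ω, g ω ∂μ = ∫ ω, G ω ∂μ := by rw [hG, integral_condExp hm]
  -- (2) the mean of the conditional covariances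
  have hmean : θ + ∫ ω, F ω * G ω ∂μ ≤ ∫ ω, H ω ∂μ := by
    have hI : Integrable (fun ω => θ + F ω * G ω) μ := (integrable_const θ).add hFGi
    have := integral_mono_ae hI hHi
      (hcov.mono fun ω h => show θ + F ω * G ω ≤ H ω by linarith)
    rwa [integral_add (integrable_const θ) hFGi, integral_const, probReal_univ, one_smul] at this
  -- (3) the covariance of the conditional means, through the centred variables `F - a`, `G - b`
  have hcm : -(ε₁ * ε₂) ≤ (∫ ω, F ω * G ω ∂μ) - (∫ ω, F ω ∂μ) * ∫ ω, G ω ∂μ := by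
    have hFam : AEStronglyMeasurable (fun ω => F ω - a) μ := hFm.sub aestronglyMeasurable_const
    have hGbm : AEStronglyMeasurable (fun ω => G ω - b) μ := hGm.sub aestronglyMeasurable_const
    have key := integral_mul_sub_ge_neg_mul_of_ae_abs_le (μ := μ) hFam hGbm ha hb
    have e1 : ∫ ω, (F ω - a) ∂μ = (∫ ω, F ω ∂μ) - a := by
      rw [integral_sub hFi (integrable_const a), integral_const, probReal_univ, one_smul]
    have e2 : ∫ ω, (G ω - b) ∂μ = (∫ ω, G ω ∂μ) - b := by
      rw [integral_sub hGi (integrable_const b), integral_const, probReal_univ, one_smul]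
    have e3 : ∫ ω, (F ω - a) * (G ω - b) ∂μ =
        (∫ ω, F ω * G ω ∂μ) - a * (∫ ω, G ω ∂μ) - b * (∫ ω, F ω ∂μ) + a * b := by
      have hid : (fun ω => (F ω - a) * (G ω - b)) =
          fun ω => F ω * G ω - a * G ω - b * F ω + a * b := by
        funext ω; ring
      have hB : Integrable (fun ω => F ω * G ω - a * G ω) μ := hFGi.sub (hGi.const_mul a)
      have hC : Integrable (fun ω => F ω * G ω - a * G ω - b * F ω) μ := hB.sub (hFi.const_mul b)
      rw [hid, integral_add hC (integrable_const _), integral_sub hB (hFi.const_mul b),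
        integral_sub hFGi (hGi.const_mul a), integral_const_mul, integral_const_mul,
        integral_const, probReal_univ, one_smul]
    rw [e1, e2, e3] at key
    nlinarith [key]
  -- assemble
  rw [h1, h2, h3]
  linarith

end CondExp

end Literature.Probability.Moments

end
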